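import Summits.Ventures.HodgeRepro2.T5QuadraticKummerDedekind
import Summits.Ventures.HodgeRepro2.T5InertPlaceGlobalPackage

/-!
# T5QuadraticInertCriterion — the census of the inert places of a quadratic extension of
# number fields: «`v` stays prime in `L = K(√d)` ⟺ `d` is not a square modulo `v`»

Tier-5 kernel support (seat p8, blind lane; sub-step N3, the census of the datum's places).
The record's CM field `E` is `F(√d)` over its totally real subfield `F` (`d ∈ 𝓞_F`, totally
negative), and its inert places `v` — the places where the whole inert-place package of
T5-146 … T5-171 applies — are exactly the finite places of `F` at which `d` is a non-square
in the residue field, `v ∤ 2d`.  This file states that census in Mathlib's vocabulary for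
number fields `K ⊆ L` with `x ∈ 𝓞_L`, `x² = d ∈ 𝓞_K`, `x ∉ 𝓞_K`:

* `minpoly_eq_X_sq_sub_C` — `minpoly (𝓞 K) x = X ^ 2 - C d`;
* `isPrime_map_iff_not_isSquare` / `exists_map_eq_asIdeal_iff_not_isSquare` — for a finite
  place `v` of `K` coprime to the conductor of `𝓞_K[x]`: `v 𝓞_L` is prime — equivalently,
  `v 𝓞_L = w` for some finite place `w` of `L` («`v` stays prime», the hypothesis `hmap` of
  T5-157 / T5-158) — iff `d` is not a square in `𝓞_K ⧸ v`;
* `map_eq_asIdeal_of_isPrime_map` — when `v 𝓞_L` is prime it IS the ideal of every place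
  `w ∣ v` (Dedekind: non-zero primes are maximal);
* the inert-place package of T5-157 / T5-158 from the Legendre condition alone:
  `ramificationIdx'_eq_one_of_not_isSquare`, `inertiaDeg'_eq_finrank_of_not_isSquare`,
  `finrank_adicCompletion_eq_two_of_not_isSquare`, `exists_isotropic_of_not_isSquare`,
  `heckeAlgebra_mul_comm_of_not_isSquare`.

The conductor condition `(conductor (𝓞 K) x).comap (algebraMap _ _) ⊔ v.asIdeal = ⊤` is carried
as a hypothesis (it holds whenever `v ∤ 2d`, since `4d` lies in the conductor of `𝓞_K[x]`).
No `sorry`, no axiom beyond `propext`, `Classical.choice`, `Quot.sound`.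
-/

namespace Summit.Ventures.HodgeRepro2.T5QuadraticInertCriterion

open Polynomial NumberField IsDedekindDomain HeightOneSpectrum

variable {K : Type*} [Field K] [NumberField K] {L : Type*} [Field L] [NumberField L] [Algebra K L]

section Minpoly

variable {x : 𝓞 L} {d : 𝓞 K}

omit [NumberField L] in
/-- If `x * x = d` with `d ∈ 𝓞 K` and `x ∉ 𝓞 K`, then `minpoly (𝓞 K) x = X ^ 2 - C d`. -/
theorem minpoly_eq_X_sq_sub_C (hx : x * x = algebraMap (𝓞 K) (𝓞 L) d)
    (hx' : x ∉ Set.range (algebraMap (𝓞 K) (𝓞 L))) :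
    minpoly (𝓞 K) x = X ^ 2 - C d := by
  have hint : IsIntegral (𝓞 K) x := Algebra.IsIntegral.isIntegral x
  have haev : aeval x (X ^ 2 - C d : (𝓞 K)[X]) = 0 := by
    rw [map_sub, map_pow, aeval_X, aeval_C, sq, hx, sub_self]
  obtain ⟨q, hq⟩ := minpoly.isIntegrallyClosed_dvd hint haev
  have hmon : (X ^ 2 - C d : (𝓞 K)[X]).Monic := monic_X_pow_sub_C d two_ne_zero
  have hmm : (minpoly (𝓞 K) x).Monic := minpoly.monic hint
  have hqm : q.Monic := hmm.of_mul_monic_left (hq ▸ hmon)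
  have hdeg : (minpoly (𝓞 K) x).natDegree + q.natDegree = 2 := by
    rw [← hmm.natDegree_mul hqm, ← hq, natDegree_X_pow_sub_C]
  have hpos : 0 < (minpoly (𝓞 K) x).natDegree := minpoly.natDegree_pos hint
  rcases Nat.lt_or_ge (minpoly (𝓞 K) x).natDegree 2 with h1 | h2
  · -- degree 1: `x` would lie in `𝓞 K`
    have h1' : (minpoly (𝓞 K) x).natDegree = 1 := by omega
    have hform := hmm.eq_X_add_C h1'
    have h0 := minpoly.aeval (𝓞 K) x
    rw [hform, map_add, aeval_X, aeval_C] at h0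
    exact absurd ⟨-(minpoly (𝓞 K) x).coeff 0, by rw [map_neg]; exact neg_eq_of_add_eq_zero_left h0⟩ hx'
  · have hq0 : q.natDegree = 0 := by omega
    rw [hqm.natDegree_eq_zero.mp hq0, mul_one] at hq
    exact hq.symm

end Minpoly

section Criterion

variable (v : HeightOneSpectrum (𝓞 K)) {x : 𝓞 L} {d : 𝓞 K}

/-- **The census of the inert places**: for a finite place `v` of `K` coprime to the conductor
of `𝓞_K[x]` and `minpoly (𝓞 K) x = X ^ 2 - C d`, the ideal `v 𝓞_L` is prime iff `d` is not a
square in the residue field `𝓞_K ⧸ v`. -/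
theorem isPrime_map_iff_not_isSquare
    (hcond : (conductor (𝓞 K) x).comap (algebraMap (𝓞 K) (𝓞 L)) ⊔ v.asIdeal = ⊤)
    (hmin : minpoly (𝓞 K) x = X ^ 2 - C d) :
    (v.asIdeal.map (algebraMap (𝓞 K) (𝓞 L))).IsPrime ↔
      ¬ IsSquare (Ideal.Quotient.mk v.asIdeal d) :=
  T5QuadraticKummerDedekind.isPrime_map_iff_not_isSquare v.isMaximal v.ne_bot hcond
    (Algebra.IsIntegral.isIntegral x) hmin

/-- The census in the vocabulary of T5-157 / T5-158: «`v` stays prime in `L`» (`v 𝓞_L = w` for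
a finite place `w` of `L`) iff `d` is not a square modulo `v`. -/
theorem exists_map_eq_asIdeal_iff_not_isSquare
    (hcond : (conductor (𝓞 K) x).comap (algebraMap (𝓞 K) (𝓞 L)) ⊔ v.asIdeal = ⊤)
    (hmin : minpoly (𝓞 K) x = X ^ 2 - C d) :
    (∃ w : HeightOneSpectrum (𝓞 L), v.asIdeal.map (algebraMap (𝓞 K) (𝓞 L)) = w.asIdeal) ↔
      ¬ IsSquare (Ideal.Quotient.mk v.asIdeal d) := by
  rw [← isPrime_map_iff_not_isSquare v hcond hmin]
  constructor
  · rintro ⟨w, hw⟩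
    rw [hw]
    exact w.isPrime
  · intro hP
    exact ⟨⟨v.asIdeal.map (algebraMap (𝓞 K) (𝓞 L)), hP,
      T5QuadraticKummerDedekind.map_ne_bot v.ne_bot⟩, rfl⟩

omit [NumberField K] in
/-- When `v 𝓞_L` is prime it is the ideal of every place `w` of `L` lying over `v`
(a non-zero prime of the Dedekind domain `𝓞 L` is maximal). -/
theorem map_eq_asIdeal_of_isPrime_map (hP : (v.asIdeal.map (algebraMap (𝓞 K) (𝓞 L))).IsPrime)
    (w : HeightOneSpectrum (𝓞 L)) [w.asIdeal.LiesOver v.asIdeal] :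
    v.asIdeal.map (algebraMap (𝓞 K) (𝓞 L)) = w.asIdeal := by
  have hle : v.asIdeal.map (algebraMap (𝓞 K) (𝓞 L)) ≤ w.asIdeal := by
    rw [Ideal.map_le_iff_le_comap, ← Ideal.under_def]
    exact (Ideal.over_def w.asIdeal v.asIdeal).le
  exact (hP.isMaximal (T5QuadraticKummerDedekind.map_ne_bot v.ne_bot)).eq_of_le
    w.isPrime.ne_top hle

/-- `d` not a square modulo `v` ⇒ `v 𝓞_L = w` for every place `w ∣ v`. -/
theorem map_eq_asIdeal_of_not_isSquare
    (hcond : (conductor (𝓞 K) x).comap (algebraMap (𝓞 K) (𝓞 L)) ⊔ v.asIdeal = ⊤)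
    (hmin : minpoly (𝓞 K) x = X ^ 2 - C d) (hd : ¬ IsSquare (Ideal.Quotient.mk v.asIdeal d))
    (w : HeightOneSpectrum (𝓞 L)) [w.asIdeal.LiesOver v.asIdeal] :
    v.asIdeal.map (algebraMap (𝓞 K) (𝓞 L)) = w.asIdeal :=
  map_eq_asIdeal_of_isPrime_map v ((isPrime_map_iff_not_isSquare v hcond hmin).mpr hd) w

end Criterion

section Package

variable (v : HeightOneSpectrum (𝓞 K)) {x : 𝓞 L} {d : 𝓞 K}
  (hcond : (conductor (𝓞 K) x).comap (algebraMap (𝓞 K) (𝓞 L)) ⊔ v.asIdeal = ⊤)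
  (hmin : minpoly (𝓞 K) x = X ^ 2 - C d) (hd : ¬ IsSquare (Ideal.Quotient.mk v.asIdeal d))
  (w : HeightOneSpectrum (𝓞 L)) [w.asIdeal.LiesOver v.asIdeal]

include hcond hmin hd

/-- `d` not a square modulo `v` ⇒ `e(w/v) = 1` (T5-157). -/
theorem ramificationIdx'_eq_one_of_not_isSquare : v.asIdeal.ramificationIdx' w.asIdeal = 1 :=
  T5InertGlobalPrime.ramificationIdx'_eq_one_of_staysPrime v w
    (map_eq_asIdeal_of_not_isSquare v hcond hmin hd w)

/-- `d` not a square modulo `v` ⇒ `f(w/v) = [L : K]` (T5-157). -/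
theorem inertiaDeg'_eq_finrank_of_not_isSquare :
    v.asIdeal.inertiaDeg' w.asIdeal = Module.finrank K L :=
  T5InertGlobalPrime.inertiaDeg'_eq_finrank_of_staysPrime v w
    (map_eq_asIdeal_of_not_isSquare v hcond hmin hd w)

/-- `d` not a square modulo `v`, `[L : K] = 2` ⇒ `[L_w : K_v] = 2` (T5-157). -/
theorem finrank_adicCompletion_eq_two_of_not_isSquare (h2 : Module.finrank K L = 2) :
    Module.finrank (v.adicCompletion K) (w.adicCompletion L) = 2 :=
  T5InertGlobalPrime.finrank_adicCompletion_eq_two_of_staysPrime v w h2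
    (map_eq_asIdeal_of_not_isSquare v hcond hmin hd w)

/-- `d` not a square modulo `v`, `[L : K] = 2` ⇒ every unimodular `σ`-hermitian `3 × 3` form
over `L_w` is isotropic (T5-158; the star is T5-125's `starRingOfQuadratic` on the derived
`[L_w : K_v] = 2`). -/
theorem exists_isotropic_of_not_isSquare (h2 : Module.finrank K L = 2)
    {ϖ : v.adicCompletionIntegers K} (hϖ : Irreducible ϖ)
    (σ : Gal(w.adicCompletion L/v.adicCompletion K)) (hσ : σ ≠ 1)
    {H : Matrix (Fin 3) (Fin 3) (w.adicCompletion L)} :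
    letI := T5StarOfInvolution.starRingOfQuadratic
      (finrank_adicCompletion_eq_two_of_not_isSquare v hcond hmin hd w h2) σ hσ
    H.IsHermitian → IsUnit H.det → ∃ y, y ≠ 0 ∧ T5UnitaryGroupIsometry.sesqForm H y y = 0 := by
  intro hH hdet
  exact T5InertPlaceGlobalPackage.exists_isotropic_of_staysPrime v w h2
    (map_eq_asIdeal_of_not_isSquare v hcond hmin hd w) hϖ σ hσ hH hdet

/-- `d` not a square modulo `v`, `[L : K] = 2` ⇒ the spherical Hecke algebra `H(U(H), K_H)` of
the record's local unitary group at `v` is commutative (T5-158; the star as above). -/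
theorem heckeAlgebra_mul_comm_of_not_isSquare (h2 : Module.finrank K L = 2)
    {ϖ : v.adicCompletionIntegers K} (hϖ : Irreducible ϖ)
    (σ : Gal(w.adicCompletion L/v.adicCompletion K)) (hσ : σ ≠ 1)
    (H : Matrix (Fin 3) (Fin 3) (w.adicCompletion L)) (k : Type*) [Field k] :
    letI := T5StarOfInvolution.starRingOfQuadratic
      (finrank_adicCompletion_eq_two_of_not_isSquare v hcond hmin hd w h2) σ hσ
    H.IsHermitian →
    (∀ i j, IsLocalization.IsInteger
      (integralClosure (v.adicCompletionIntegers K) (w.adicCompletion L)) (H i j)) →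
    IsUnit H.det →
    (∀ i j, IsLocalization.IsInteger
      (integralClosure (v.adicCompletionIntegers K) (w.adicCompletion L)) (H⁻¹ i j)) →
    ∀ T S : T5HeckePermutationModule.heckeAlgebra k
      (T5UnitaryHeckeAdjoint.hyperspecialSubgroup
        (integralClosure (v.adicCompletionIntegers K) (w.adicCompletion L)) H),
    T * S = S * T := by
  intro hH hint hdet hinv T S
  exact T5InertPlaceGlobalPackage.heckeAlgebra_mul_comm_of_staysPrime v w h2
    (map_eq_asIdeal_of_not_isSquare v hcond hmin hd w) hϖ σ hσ H k hH hint hdet hinv T S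

end Package

end Summit.Ventures.HodgeRepro2.T5QuadraticInertCriterion
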